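import Summits.BirchSwinnertonDyer.Rank1Residual.AdditivePotMult.PotMultCongruentPartnerEPW
import Summits.BirchSwinnertonDyer.Rank1Residual.AdditivePotMult.RamifiedOrdinaryLineMatching
import HarnessLib

/-!
# X4(M) ∧ surj(p) ∧ `r_an = 0`, EVERY odd `p`: the (M)–(M) congruent-partner ends of
# `PotMultCongruentPartnerEPW.lean` with the RAMIFIED ORDINARY LINES and the LINE-RESPECTING clause
# DISCHARGED — a plain congruence `E[p] ≃ E₁[p]` suffices (cell `b2b-bsdres`, team n1011, seat p07
# (gen 4), row TB-ROL SEQUEL; lead R5-32 (a) / R5-34)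

HONEST FRAMING (cell `b2b-bsdres`, run/shared/lean/b2b/bsd-rank1-residual/, verbatim in every
file): the goal of the cell is to DELETE the COMBINATION-SHAPED residual classes of the
Birch–Swinnerton-Dyer formula for ALL analytic-rank `≤ 1` elliptic curves over `ℚ` — "full BSD
formula for every rank `≤ 1` curve in class `C`" assembled STRICTLY from published theorems — so
that the rank-`≤ 1` remainder becomes exactly the CONSTRUCTION-SHAPED classes, which are TYPED
(missing-input `Prop`s), NOT attempted. This is not "finishing BSD". Team n1011 (RESIDUAL-MAP §I
N10 / N11 LOWER half on the (M) rows = X4(M) ∧ surj(p) ∧ `r_an = 0`, every odd `p`): research route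
on CONSTRUCTION-SHAPED items; labels and marks UNCHANGED; nothing booked — every statement below is
PER PAIR modulo the named facts AND per-pair inputs outside the kernel (the census record =
CERTIFICATE-EVIDENCE; the congruence and `Σ₀` = per-pair data); booking = director, per pair, after
countersign. Theorems only; NO Literature fact minted; NO definition. Named facts as HYPOTHESES
only: `hK` (Kato 17.4 (3)), `hEPW` (Emerton–Pollack–Weston 3.3.2 / 3.3.3 (2) + Lemma 5.1.5),
`hDel`/`hDelX` (Delbourgo 1998 Prop. 4), `hPal` (Pal 2012, even branch only), `hGZK`, `hmod`, `hmodD`,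
and — NEW relative to FILE 3 — `hT40`/`hT41` (Silverman *ATAEC* V.3.1/V.5.3/V.5.4, the PUBLISHED Tate
uniformisation facts A40/A41, exactly as in every X2 Tate file). Debt 0.

## What and why

FILE 3 (`PotMultCongruentPartnerEPW`, p256693) closed `BSD(E,p)` on an (M)–(M) congruent pair from
the record at `E` + the EPW transfer + a partner of enough rank, taking PER PAIR two ramified ordinary
lines `L`, `L₁` (`IsRamifiedOrdinaryLine`) and a congruence `E[p] ≃ E₁[p]` RESPECTING them. Row
TB-ROL made the lines theorems (`RamifiedOrdinaryLinePotMult`: the Tate line of the multiplicative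
`p*`-twist model, transported; mod A40/A41) and proved that the line-respecting clause is AUTOMATIC
for any `Γ_ℚ`-equivariant congruence between two such rows (`RamifiedOrdinaryLineMatching`: common
inertia signature `2ε` on `C[p]`, `ε` on the quotient). This file performs the consumer swap:

* `ClassX4M.budgetLeLambdaAt_of_epw_of_multPartner_of_congr` — the Route-G budget
  `BudgetLeLambdaAt p W b` for `E`, `E₁` both X4(M), `E₁` surjective at `p` with `r₁ ≤ rank E₁(ℚ)`,
  a PLAIN `Γ_ℚ`-equivariant `E[p] ≃+ E₁[p]`, `Σ₀`, `b ≤ r₁ + Σ (δ₁ − δ)`;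
* `ClassX4M.bsdp_rankZero_of_surj_of_katoHalf_of_firstUnitIndex_of_epw_of_multPartner_of_congr`
  (+ `_three_`) — `BSD(E,p)` in rank `0` on such a pair from the record at `E` alone on the `E` side.
Per (M)–(M) pair the residual inputs are now EXACTLY: ONE unit coefficient at `E` (the record), the
congruence (census `TorsionIso` currency), `Σ₀`, and a partner of rank `≥ r₁`.

What is NOT claimed: mixed (M)–(G-ord) pairs (no transport in print, cc-typer-1 N11/TRANSPORT v5);
(G-ord)–(G-ord) pairs (the same swap needs the shape clauses of the good-ordinary line — n1011-p10's
`GordRamifiedOrdinaryLine` side); rows without a congruent partner of enough rank; non-surjective rows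
(O8); `r_an = 1`; `p = 2`. X4(M) stays CONSTRUCTION-SHAPED; nothing booked.

References: M. Emerton, R. Pollack, T. Weston, Invent. Math. 163 (2006) pp. 2–3, Thms. 3.3.2, 3.3.3,
Lemma 5.1.5; K. Kato, Astérisque 295 (2004) Thm. 17.4; D. Delbourgo, Compositio Math. 113 (1998)
Prop. 4; A. Pal, Thm. 3.2 (2012); R. L. Miller, LMS J. Comput. Math. 14 (2011) Def. 1.1;
J. H. Silverman, *ATAEC* V.5.3–5.4.
-/

set_option autoImplicit false

noncomputable section

open scoped Classical MatrixGroups ModularForm NumberField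

namespace Summit.BirchSwinnertonDyer.Rank1Residual.AdditivePotMult

open CongruenceSubgroup WeierstrassCurve NumberField IsDedekindDomain Field
  Literature.NumberTheory.EllipticCurves
  Literature.NumberTheory.EllipticCurves.ModularForms
  Literature.NumberTheory.EllipticCurves.Rank1Residual
  Literature.NumberTheory.EllipticCurves.Rank1Residual.Typed
  Literature.NumberTheory.EllipticCurves.GreenbergSelmer
  Literature.NumberTheory.EllipticCurves.GreenbergVatsal2000
  Literature.NumberTheory.EllipticCurves.EmertonPollackWeston2006
  Literature.NumberTheory.GaloisRepresentations
  Summit.BirchSwinnertonDyer.Rank1Residual.Additive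
  Summit.BirchSwinnertonDyer.Rank1Residual.Additive.CensusQ6

section Ends

variable {W W₁ : WeierstrassCurve ℚ} [W.IsElliptic] [W.IsGloballyMinimal] [W₁.IsElliptic]
  [W₁.IsGloballyMinimal] {p : ℕ} [hp : Fact p.Prime]

/-- **The budget from an (M) congruent partner — lines DISCHARGED.** For `E = W` and `E₁ = W₁` both
X4(M) at the odd prime `p`, the partner surjective at `p` with `r₁ ≤ rank E₁(ℚ)`, a PLAIN
`Γ_ℚ`-equivariant congruence `E[p] ≃+ E₁[p]` (the census's `TorsionIso` currency) and `Σ₀ ∌ p` outside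
which both curves are good: `BudgetLeLambdaAt p W b` for every `b ≤ r₁ + Σ_{w∈Σ₀} (δ(E₁,w) − δ(E,w))`.
The two ramified ordinary lines and the line-respecting clause that
`budgetLeLambdaAt_of_epw_of_partnerRank` (FILE 3) takes per pair are now THEOREMS
(`PotMult.exists_lines_matching`, mod the published Tate uniformisation A40/A41); the partner input is
§2 of FILE 3 (Kato's divisibility alone). Named facts as hypotheses: `hK`, `hmodD`, `hEPW`, `hT40`,
`hT41`. PER PAIR; X4(M) stays CONSTRUCTION-SHAPED; nothing booked.
[cite: EmertonPollackWeston2006, Thm. 3.3.2, Thm. 3.3.3 (2) (arXiv:math/0404484 p. 19), Lemma 5.1.5 (p. 30) and pp. 2–3]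
[cite: Kato2004Asterisque, Thm. 17.4 (3) (p. 273)] [cite: SilvermanATAEC1994, Ch. V Thm. 5.3, Cor. 5.4] -/
theorem ClassX4M.budgetLeLambdaAt_of_epw_of_multPartner_of_congr
    (hK : Wuthrich2014.kato_halfEigenCharIdeal_dvd_cyclotomicPrime_of_surjective)
    (hmodD : nonempty_modularParametrizationData)
    (hEPW : muLambdaAlg_transfer_of_torsionIso_potOrd)
    (hT40 : Silverman1994_thmV53_tateUniformisation.{0})
    (hT41 : Silverman1994_thmV53_corV54_tateUniformisation.{0})
    (hX : ClassX4M W p) (hX₁ : ClassX4M W₁ p) (hsurj₁ : Surj W₁ p) {r₁ : ℕ}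
    (hr₁ : r₁ ≤ W₁.mordellWeilRank) {v : HeightOneSpectrum (𝓞 ℚ)} (hv : ((p : ℕ) : 𝓞 ℚ) ∈ v.asIdeal)
    (hcong : ∃ e : geomTorsion W (p : ℤ) ≃+ geomTorsion W₁ (p : ℤ),
      ∀ (σ : absoluteGaloisGroup ℚ) (P : geomTorsion W (p : ℤ)), e (σ • P) = σ • e P)
    (S₀ : Finset (HeightOneSpectrum (𝓞 ℚ))) (hS₀ : ∀ w ∈ S₀, ((p : ℕ) : 𝓞 ℚ) ∉ w.asIdeal)
    (hS : ∀ w : HeightOneSpectrum (𝓞 ℚ), w ∉ S₀ → ((p : ℕ) : 𝓞 ℚ) ∉ w.asIdeal →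
      W.HasGoodReductionAt w)
    (hS₁ : ∀ w : HeightOneSpectrum (𝓞 ℚ), w ∉ S₀ → ((p : ℕ) : 𝓞 ℚ) ∉ w.asIdeal →
      W₁.HasGoodReductionAt w)
    {b : ℕ} (hb : (b : ℤ) ≤ r₁ + ∑ w ∈ S₀, ((delta W₁ p w : ℤ) - (delta W p w : ℤ))) :
    BudgetLeLambdaAt p W b := by
  obtain ⟨L, L₁, hL, hL₁, hmatch⟩ := (ClassX4M.potMult W p hX).exists_lines_matching hT40 hT41
    (ClassX4M.potMult W₁ p hX₁) hX.p_ne_two hv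
  obtain ⟨e, he⟩ := hcong
  exact budgetLeLambdaAt_of_epw_of_partnerRank hEPW hX.p_ne_two hv hL hL₁ hX.irr ⟨e, he, hmatch e he⟩
    S₀ hS₀ hS hS₁ (fun hκ hγ hγ' D₁ _ ↦
      hX₁.isTorsion_and_le_lambdaInvariant_of_katoHalf hK hmodD hsurj₁ hr₁ hκ hγ hγ' D₁) hb

/-- **(M)–(M) congruent pair via EPW, fully composed, EVERY odd `p` (`p = 3` included) — with the
ramified ordinary lines and the line-respecting clause DISCHARGED.** `E = W` X4(M) ∧ surj(p) ∧
`r_an = 0` with the record at index `b`; partner `E₁ = W₁` X4(M) ∧ surj(p) with `r₁ ≤ rank E₁(ℚ)`; a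
PLAIN `Γ_ℚ`-equivariant congruence `E[p] ≃+ E₁[p]`; `Σ₀`; `b ≤ r₁ + Σ_{w∈Σ₀} (δ(E₁,w) − δ(E,w))` ⟹
`BSD(E,p)`. Compared with FILE 3's
`ClassX4M.bsdp_rankZero_of_surj_of_katoHalf_of_firstUnitIndex_of_epw_of_multPartner` the per-pair
residual inputs are now EXACTLY: ONE unit coefficient at `E` (the record), the congruence, `Σ₀`, and a
partner of rank `≥ r₁` — the line data are gone (TB-ROL: FILE A p259159, FILE B-M, FILE C), at the
price of the two PUBLISHED Tate-uniformisation facts A40/A41 as hypotheses.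
[cite: Kato2004Asterisque, Thm. 17.4 (3) (p. 273)] [cite: EmertonPollackWeston2006, Thm. 3.3.2, Thm. 3.3.3 (2) (arXiv:math/0404484 p. 19), Lemma 5.1.5 (p. 30) and pp. 2–3]
[cite: Delbourgo1998, Prop. 4 (p. 144)] [cite: Pal2012, Thm. 3.2] [cite: Miller2011LMS, Def. 1.1]
[cite: SilvermanATAEC1994, Ch. V Thm. 5.3, Cor. 5.4] -/
theorem ClassX4M.bsdp_rankZero_of_surj_of_katoHalf_of_firstUnitIndex_of_epw_of_multPartner_of_congr
    (hK : Wuthrich2014.kato_halfEigenCharIdeal_dvd_cyclotomicPrime_of_surjective)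
    (hEPW : muLambdaAlg_transfer_of_torsionIso_potOrd)
    (hDel : Delbourgo1998.prop4_rankZero_pow_dvd_constantCoeff)
    (hDelX : Delbourgo1998.prop4_rankZero_constantCoeff_eq_unit_mul_of_potMult)
    (hPal : Pal2012.thm32_sqrt_mul_realPeriodRat_twist_eq_of_prime_one_mod_four)
    (hGZK : rank_eq_analyticRank_of_analyticRank_le_one) (hmod : hasEntireLFunction_rat)
    (hmodD : nonempty_modularParametrizationData)
    (hT40 : Silverman1994_thmV53_tateUniformisation.{0})
    (hT41 : Silverman1994_thmV53_corV54_tateUniformisation.{0})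
    (hX : ClassX4M W p) (hsurj : Surj W p) (hr : W.analyticRank = 0) {b : ℕ}
    (hrec : (p % 4 = 1 → MultFirstUnitIndexAt W p b) ∧ (p % 4 = 3 → MultOddFirstUnitIndexAt W p b))
    (hX₁ : ClassX4M W₁ p) (hsurj₁ : Surj W₁ p) {r₁ : ℕ} (hr₁ : r₁ ≤ W₁.mordellWeilRank)
    {v : HeightOneSpectrum (𝓞 ℚ)} (hv : ((p : ℕ) : 𝓞 ℚ) ∈ v.asIdeal)
    (hcong : ∃ e : geomTorsion W (p : ℤ) ≃+ geomTorsion W₁ (p : ℤ),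
      ∀ (σ : absoluteGaloisGroup ℚ) (P : geomTorsion W (p : ℤ)), e (σ • P) = σ • e P)
    (S₀ : Finset (HeightOneSpectrum (𝓞 ℚ))) (hS₀ : ∀ w ∈ S₀, ((p : ℕ) : 𝓞 ℚ) ∉ w.asIdeal)
    (hS : ∀ w : HeightOneSpectrum (𝓞 ℚ), w ∉ S₀ → ((p : ℕ) : 𝓞 ℚ) ∉ w.asIdeal →
      W.HasGoodReductionAt w)
    (hS₁ : ∀ w : HeightOneSpectrum (𝓞 ℚ), w ∉ S₀ → ((p : ℕ) : 𝓞 ℚ) ∉ w.asIdeal →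
      W₁.HasGoodReductionAt w)
    (hb : (b : ℤ) ≤ r₁ + ∑ w ∈ S₀, ((delta W₁ p w : ℤ) - (delta W p w : ℤ))) : BSDp W p := by
  obtain ⟨L, L₁, hL, hL₁, hmatch⟩ := (ClassX4M.potMult W p hX).exists_lines_matching hT40 hT41
    (ClassX4M.potMult W₁ p hX₁) hX.p_ne_two hv
  obtain ⟨e, he⟩ := hcong
  exact hX.bsdp_rankZero_of_surj_of_katoHalf_of_firstUnitIndex_of_epw_of_multPartner hK hEPW hDel
    hDelX hPal hGZK hmod hmodD hsurj hr hrec hX₁ hsurj₁ hr₁ hv hL hL₁ ⟨e, he, hmatch e he⟩ S₀ hS₀ hS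
    hS₁ hb

/-- **`p = 3` specialisation, lines DISCHARGED** (the N11 (M) rows; record on the odd branch
`MultOddFirstUnitIndexAt W 3 b`): (M)–(M) congruent pair at `3` with a plain congruence `E[3] ≃ E₁[3]`
⟹ `BSD(E,3)` from the record at `E`, `Σ₀`, and a partner of rank `≥ r₁`.
[cite: Kato2004Asterisque, Thm. 17.4 (3) (p. 273)] [cite: EmertonPollackWeston2006, Thm. 3.3.3 (2) (arXiv:math/0404484 p. 19) and pp. 2–3]
[cite: Delbourgo1998, Prop. 4 (p. 144)] [cite: Miller2011LMS, Def. 1.1] [cite: SilvermanATAEC1994, Ch. V Thm. 5.3, Cor. 5.4] -/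
theorem ClassX4M.bsdp_three_rankZero_of_surj_of_katoHalf_of_firstUnitIndex_of_epw_of_multPartner_of_congr
    [Fact (Nat.Prime 3)] {W W₁ : WeierstrassCurve ℚ} [W.IsElliptic] [W.IsGloballyMinimal]
    [W₁.IsElliptic] [W₁.IsGloballyMinimal]
    (hK : Wuthrich2014.kato_halfEigenCharIdeal_dvd_cyclotomicPrime_of_surjective)
    (hEPW : muLambdaAlg_transfer_of_torsionIso_potOrd)
    (hDel : Delbourgo1998.prop4_rankZero_pow_dvd_constantCoeff)
    (hDelX : Delbourgo1998.prop4_rankZero_constantCoeff_eq_unit_mul_of_potMult)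
    (hPal : Pal2012.thm32_sqrt_mul_realPeriodRat_twist_eq_of_prime_one_mod_four)
    (hGZK : rank_eq_analyticRank_of_analyticRank_le_one) (hmod : hasEntireLFunction_rat)
    (hmodD : nonempty_modularParametrizationData)
    (hT40 : Silverman1994_thmV53_tateUniformisation.{0})
    (hT41 : Silverman1994_thmV53_corV54_tateUniformisation.{0})
    (hX : ClassX4M W 3) (hsurj : Surj W 3) (hr : W.analyticRank = 0) {b : ℕ}
    (hrec : MultOddFirstUnitIndexAt W 3 b)
    (hX₁ : ClassX4M W₁ 3) (hsurj₁ : Surj W₁ 3) {r₁ : ℕ} (hr₁ : r₁ ≤ W₁.mordellWeilRank)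
    {v : HeightOneSpectrum (𝓞 ℚ)} (hv : ((3 : ℕ) : 𝓞 ℚ) ∈ v.asIdeal)
    (hcong : ∃ e : geomTorsion W ((3 : ℕ) : ℤ) ≃+ geomTorsion W₁ ((3 : ℕ) : ℤ),
      ∀ (σ : absoluteGaloisGroup ℚ) (P : geomTorsion W ((3 : ℕ) : ℤ)), e (σ • P) = σ • e P)
    (S₀ : Finset (HeightOneSpectrum (𝓞 ℚ))) (hS₀ : ∀ w ∈ S₀, ((3 : ℕ) : 𝓞 ℚ) ∉ w.asIdeal)
    (hS : ∀ w : HeightOneSpectrum (𝓞 ℚ), w ∉ S₀ → ((3 : ℕ) : 𝓞 ℚ) ∉ w.asIdeal →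
      W.HasGoodReductionAt w)
    (hS₁ : ∀ w : HeightOneSpectrum (𝓞 ℚ), w ∉ S₀ → ((3 : ℕ) : 𝓞 ℚ) ∉ w.asIdeal →
      W₁.HasGoodReductionAt w)
    (hb : (b : ℤ) ≤ r₁ + ∑ w ∈ S₀, ((delta W₁ 3 w : ℤ) - (delta W 3 w : ℤ))) : BSDp W 3 :=
  hX.bsdp_rankZero_of_surj_of_katoHalf_of_firstUnitIndex_of_epw_of_multPartner_of_congr hK hEPW hDel
    hDelX hPal hGZK hmod hmodD hT40 hT41 hsurj hr ⟨fun h ↦ absurd h (by norm_num), fun _ ↦ hrec⟩ hX₁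
    hsurj₁ hr₁ hv hcong S₀ hS₀ hS hS₁ hb

end Ends

end Summit.BirchSwinnertonDyer.Rank1Residual.AdditivePotMult

end
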